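import Summits.CriticalPhenomena.Ising3DConformalLimit.Theorems.StrandShadow.Negative.ClusterDecomposition
import Summits.CriticalPhenomena.Ising3DConformalLimit.Theorems.StrandShadow.Negative.PairSplitDeletion
import Summits.CriticalPhenomena.Ising3DConformalLimit.Theorems.FKParityRobustnessParityBoundCurrents
import Literature.Probability.LatticeModels.CurrentSwitching
import Literature.Probability.LatticeModels.LoopO1
import HarnessLib

/-!
# Aizenman's `U₄` identity in loop-O(1) dress: the pairing side (crux `StrandShadow`, stmt-CriticalPhenomena-14626)

Support file for the stub `stub_aizenmanLoopDictionary` of the line `odd-cluster-cut-exact-helper`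
(route `FKParityRobustness`, sub-problem `Ising3DConformalLimit`).  Finite graph `G`, `β ≥ 0`,
`t = tanh β`, four marked vertices `a : Fin 4 → V` (injective), `𝒯_S = tJoins G univ S`,
`Z_S = Σ_{F ∈ 𝒯_S} t^{|F|}` the sourced loop-O(1) partition functions.

* `aizLoop_pairingPartition` (registered helper) — the PAIRING DECOMPOSITION
  `Z_A = C₂₃ + C₁₃ + C₁₂ + AJ`: the `a₀`-cluster of `F ∈ 𝒯_A` contains an even number of the
  marked vertices (`aizLoop_even_card_rch`, handshake `even_card_odd_edeg` in the cluster
  `clusterEdges F a₀`), so it avoids exactly two of `a₁, a₂, a₃` or contains all three.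
* `aizLoop_pairingsIdentity` — the PRODUCT FORM of Aizenman's identity
  `−U₄·Z_∅² = 2·Σ_{F ∈ 𝒯_A} Σ_{F′ ∈ 𝒯_∅} Σ_{η ⊆ E} t^{|F|+|F′|} (t²)^{|η|}(1−t²)^{|E|−|η|} 1[A joined in F ∪ F′ ∪ η]`,
  i.e. `Z₀₁Z₂₃ + Z₀₂Z₁₃ + Z₀₃Z₁₂ = Z_A Z_∅ + 2·JJ`, CONDITIONAL on the same-graph two-current
  trace dictionary (hypothesis `hSelf`: the trace of `n₁ + n₂` under `1{∂n₁ = A}1{∂n₂ = B} w w`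
  is `odd(n₁) ∪ odd(n₂) ∪ η`, `η ~ Bernoulli(t²)^{⊗E}`).  Proof: the random-current identity
  `Current.ursellFour_currentSum_identity` (`Σ_{pairings} Z[ab]Z[cd] = Z[D]Z[∅] + 2P`), the pair
  switching `Current.tsum_epairWeight_switch_pair`
  (`P = Σ 1{∂n₁ = D}1{∂n₂ = ∅} w w 1[a₂ ∈ C(a₀)]1[a₃ ∈ C(a₂)]`), parity of sources per cluster
  (`aizLoop_indicator_eq`, from `Current.even_card_sources_cluster`: the product indicator is
  `1[A joined in trace(n₁+n₂)]`), the dictionary, and `Z[S] = cosh(β)^{|E|} Z_S`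
  (`aizLoop_ecurrentSum_eq`, the `sinh/cosh` expansion `tsum_sources_eweight_mul_apply_oddPart`).

References: M. Aizenman, Comm. Math. Phys. 86 (1982), Prop. 5.1 [AizenmanCMP1982];
M. Aizenman, H. Duminil-Copin, Ann. of Math. 194 (2021), §3 [AizenmanDuminilCopinAnnals2021];
U. T. Hansen, J. Jiang, F. R. Klausen, arXiv:2506.10765, §2 (2.5) [HansenJiangKlausen2025].
-/

noncomputable section

open Finset SimpleGraph
open scoped ENNReal symmDiff
open Literature.Probability.LatticeModels
open Summit.CriticalPhenomena.Ising3DConformalLimit.StrandShadowNegative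

namespace Summit.CriticalPhenomena.Ising3DConformalLimit.Theorems.StrandShadowOddCut

open scoped Classical

/-! ## The pairing decomposition of `𝒯_A` -/

section LoopSide

variable {V : Type*} [Fintype V] [DecidableEq V] (G : SimpleGraph V) [DecidableRel G.Adj]

/-- Handshake in the `a₀`-cluster of an `A`-join: the number of marked vertices `a i` joined to
`a 0` inside `F ∈ 𝒯_A` is even (the odd-degree vertices of the cluster `K_{a₀}(F)` are exactly the
marked vertices it contains). -/
theorem aizLoop_even_card_rch {a : Fin 4 → V} (ha : Function.Injective a) {F : Finset (Sym2 V)}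
    (hF : F ∈ tJoins G Set.univ (Finset.univ.image a)) :
    Even #(univ.filter fun i : Fin 4 => Rch F (a 0) (a i)) := by
  rw [mem_tJoins_univ] at hF
  obtain ⟨hFG, hFodd⟩ := hF
  have hdiag : ∀ e ∈ clusterEdges F (a 0), ¬ e.IsDiag := fun e he =>
    SimpleGraph.not_isDiag_of_mem_edgeSet G
      (SimpleGraph.mem_edgeFinset.1 (hFG (clusterEdges_subset F (a 0) he)))
  have heven := even_card_odd_edeg hdiag
  have hO : (univ.filter fun v => Odd (edeg (clusterEdges F (a 0)) v)) =
      (univ.filter fun i : Fin 4 => Rch F (a 0) (a i)).image a := by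
    ext v
    simp only [mem_filter, mem_univ, true_and, mem_image]
    constructor
    · intro hv
      by_cases hr : Rch F (a 0) v
      · rw [odd_edeg_clusterEdges_iff hr, hFodd v] at hv
        obtain ⟨i, -, rfl⟩ := mem_image.1 hv
        exact ⟨i, hr, rfl⟩
      · rw [edeg_clusterEdges_eq_zero hr] at hv
        exact absurd hv Nat.not_odd_zero
    · rintro ⟨i, hi, rfl⟩
      rw [odd_edeg_clusterEdges_iff hi, hFodd]
      exact mem_image_of_mem a (mem_univ i)
  rwa [hO, card_image_of_injective _ ha] at heven

end LoopSide

/-- **aizLoop_pairingPartition** — the pairing decomposition of `Z_A`.  For `F ∈ 𝒯_A`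
(`A = {a 0, a 1, a 2, a 3}`, `a` injective) exactly one of the four events "the `a₀`-cluster avoids
`a₂, a₃`", "avoids `a₁, a₃`", "avoids `a₁, a₂`", "contains `a₁, a₂, a₃`" holds (the `a₀`-cluster
contains an even number of marked vertices), so `Z_A = C₂₃ + C₁₃ + C₁₂ + AJ` for every real `t`. -/
theorem aizLoop_pairingPartition :
    ∀ (V : Type) [Fintype V] [DecidableEq V] (G : SimpleGraph V) [DecidableRel G.Adj] (t : ℝ)
      (a : Fin 4 → V), Function.Injective a →
      ∑ F ∈ tJoins G Set.univ (Finset.univ.image a), t ^ F.card =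
        (∑ F ∈ (tJoins G Set.univ (Finset.univ.image a)).filter (fun F : Finset (Sym2 V) =>
            ¬ (SimpleGraph.fromEdgeSet (↑F : Set (Sym2 V))).Reachable (a 0) (a 2) ∧
            ¬ (SimpleGraph.fromEdgeSet (↑F : Set (Sym2 V))).Reachable (a 0) (a 3)), t ^ F.card) +
        (∑ F ∈ (tJoins G Set.univ (Finset.univ.image a)).filter (fun F : Finset (Sym2 V) =>
            ¬ (SimpleGraph.fromEdgeSet (↑F : Set (Sym2 V))).Reachable (a 0) (a 1) ∧
            ¬ (SimpleGraph.fromEdgeSet (↑F : Set (Sym2 V))).Reachable (a 0) (a 3)), t ^ F.card) +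
        (∑ F ∈ (tJoins G Set.univ (Finset.univ.image a)).filter (fun F : Finset (Sym2 V) =>
            ¬ (SimpleGraph.fromEdgeSet (↑F : Set (Sym2 V))).Reachable (a 0) (a 1) ∧
            ¬ (SimpleGraph.fromEdgeSet (↑F : Set (Sym2 V))).Reachable (a 0) (a 2)), t ^ F.card) +
        ∑ F ∈ (tJoins G Set.univ (Finset.univ.image a)).filter (fun F : Finset (Sym2 V) =>
            (SimpleGraph.fromEdgeSet (↑F : Set (Sym2 V))).Reachable (a 0) (a 1) ∧
            (SimpleGraph.fromEdgeSet (↑F : Set (Sym2 V))).Reachable (a 0) (a 2) ∧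
            (SimpleGraph.fromEdgeSet (↑F : Set (Sym2 V))).Reachable (a 0) (a 3)), t ^ F.card := by
  intro V _ _ G _ t a ha
  rw [Finset.sum_filter, Finset.sum_filter, Finset.sum_filter, Finset.sum_filter,
    ← Finset.sum_add_distrib, ← Finset.sum_add_distrib, ← Finset.sum_add_distrib]
  refine Finset.sum_congr rfl fun F hF => ?_
  have h := aizLoop_even_card_rch G ha hF
  rw [Finset.card_filter, Fin.sum_univ_four, if_pos (rch_refl F (a 0))] at h
  by_cases h1 : Rch F (a 0) (a 1) <;> by_cases h2 : Rch F (a 0) (a 2) <;>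
    by_cases h3 : Rch F (a 0) (a 3) <;>
    simp only [h1, h2, h3, if_true, if_false, not_true_eq_false, not_false_eq_true, and_self,
      and_true, and_false, add_zero, zero_add] at h ⊢ <;>
    exact absurd h (by decide)

/-! ## Current-side bookkeeping -/

section CurrentSide

variable {V : Type*} [Fintype V] [DecidableEq V] (G : SimpleGraph V) [DecidableRel G.Adj]

/-- `Z_β[S] = cosh(β)^{|E|} · Z^S_{tanh β}(G)` in `ℝ≥0∞` (the `sinh/cosh` expansion of the sourced
current sum, `tsum_sources_eweight_mul_apply_oddPart` with `g = 1`). -/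
theorem aizLoop_ecurrentSum_eq {β : ℝ} (hβ : 0 ≤ β) (S : Finset V) :
    ecurrentSum (fun _ : G.edgeFinset => β) S =
      ENNReal.ofReal (Real.cosh β ^ #G.edgeFinset * loopO1PartitionFunction G (Real.tanh β) S) := by
  -- adapted from `ecurrentSum_empty_eq_ofReal` (Theorems/FKParityRobustnessParityBoundCurrents.lean)
  have ht : 0 ≤ Real.tanh β := by
    rw [Real.tanh_eq_sinh_div_cosh]
    exact div_nonneg (Real.sinh_nonneg_iff.2 hβ) (Real.cosh_pos β).le
  have h := tsum_sources_eweight_mul_apply_oddPart (G := G) hβ S (fun _ => 1)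
  simp only [mul_one] at h
  have hT : tJoins G Set.univ S =
      G.edgeFinset.powerset.filter (fun F => ∀ v, Odd #(F.filter (v ∈ ·)) ↔ v ∈ S) := by
    unfold tJoins
    exact Finset.filter_congr fun F _ => by simp only [Set.subset_univ, true_and]
  unfold ecurrentSum
  rw [h, loopO1PartitionFunction_eq_sum_tJoins, Finset.mul_sum,
    ENNReal.ofReal_sum_of_nonneg (fun F _ => by positivity), hT, Finset.sum_filter]
  refine Finset.sum_congr rfl fun F hF => ?_
  have hle : #F ≤ #G.edgeFinset := Finset.card_le_card (Finset.mem_powerset.1 hF)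
  split_ifs
  · rw [sinh_pow_mul_cosh_pow_sub β hle]
  · rfl

omit [DecidableEq V] in
/-- The trace of a current, read as an edge finset, spans the traced graph: reachability inside
`{e ∈ E(G) : e ∈ trace n}` is cluster membership. -/
theorem aizLoop_rch_trace_iff (n : Current G) (x y : V) :
    Rch (G.edgeFinset.filter fun e => e ∈ n.traced) x y ↔ y ∈ n.cluster x := by
  have hS : (↑(G.edgeFinset.filter fun e => e ∈ n.traced) : Set (Sym2 V)) = n.traced := by
    ext e
    simp only [Finset.coe_filter, Set.mem_setOf_eq, SimpleGraph.mem_edgeFinset, and_iff_right_iff_imp]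
    exact fun he => Current.traced_subset_edgeSet n he
  rw [Current.mem_cluster_iff, Rch, hS]
  rfl

/-- **Parity of sources per cluster, four sources.**  If `∂n = {a 0, a 1, a 2, a 3}` (injective
`a`), then `a₂ ∈ C_n(a₀)` and `a₃ ∈ C_n(a₂)` already force all four marked vertices into one
cluster of the trace (`a₁` joins by the handshake `Current.even_card_sources_cluster`); indicator
form against the trace read as an edge finset. -/
theorem aizLoop_indicator_eq {a : Fin 4 → V} (ha : Function.Injective a) {n : Current G}
    (hn : n.sources = Finset.univ.image a) :
    ((if a 2 ∈ n.cluster (a 0) then (1 : ℝ≥0∞) else 0) *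
        (if a 3 ∈ n.cluster (a 2) then (1 : ℝ≥0∞) else 0)) =
      if (∀ i j : Fin 4, Rch (G.edgeFinset.filter fun e => e ∈ n.traced) (a i) (a j)) then 1
      else 0 := by
  by_cases hall : ∀ i j : Fin 4, Rch (G.edgeFinset.filter fun e => e ∈ n.traced) (a i) (a j)
  · rw [if_pos hall, if_pos ((aizLoop_rch_trace_iff G n _ _).1 (hall 0 2)),
      if_pos ((aizLoop_rch_trace_iff G n _ _).1 (hall 2 3)), mul_one]
  rw [if_neg hall]
  by_cases h02 : a 2 ∈ n.cluster (a 0)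
  · by_cases h23 : a 3 ∈ n.cluster (a 2)
    · exfalso
      apply hall
      have h03 : a 3 ∈ n.cluster (a 0) := Current.mem_cluster_trans h02 h23
      have h01 : a 1 ∈ n.cluster (a 0) := by
        by_contra h01
        have heven := Current.even_card_sources_cluster n (a 0) (n.cluster (a 0))
          (fun v => Current.mem_cluster_iff)
        have hset : (n.cluster (a 0)).filter (fun v => v ∈ n.sources) =
            (univ.filter fun i : Fin 4 => a i ∈ n.cluster (a 0)).image a := by
          ext v
          simp only [hn, mem_filter, mem_image, mem_univ, true_and]
          constructor
          · rintro ⟨hv, i, rfl⟩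
            exact ⟨i, hv, rfl⟩
          · rintro ⟨i, hi, rfl⟩
            exact ⟨hi, i, rfl⟩
        rw [hset, card_image_of_injective _ ha, Finset.card_filter, Fin.sum_univ_four,
          if_pos (Current.mem_cluster_self n (a 0)), if_neg h01, if_pos h02, if_pos h03] at heven
        exact absurd heven (by decide)
      have hmem : ∀ i : Fin 4, a i ∈ n.cluster (a 0) := by
        intro i
        fin_cases i
        · exact Current.mem_cluster_self n (a 0)
        · exact h01
        · exact h02
        · exact h03
      intro i j
      rw [aizLoop_rch_trace_iff]
      exact Current.mem_cluster_trans (Current.mem_cluster_comm.1 (hmem i)) (hmem j)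
    · rw [if_neg h23, mul_zero]
  · rw [if_neg h02, zero_mul]

omit [Fintype V] in
/-- The four-source set `{a 0} ∆ {a 1} ∆ {a 2} ∆ {a 3}` of an injective `a` is its image. -/
theorem aizLoop_symmDiff_eq_image {a : Fin 4 → V} (ha : Function.Injective a) :
    ({a 0} : Finset V) ∆ ({a 1} ∆ ({a 2} ∆ {a 3})) = Finset.univ.image a := by
  ext v
  simp only [Finset.mem_symmDiff, Finset.mem_singleton, Finset.mem_image, Finset.mem_univ,
    true_and]
  constructor
  · intro h
    by_cases h0 : v = a 0
    · exact ⟨0, h0.symm⟩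
    by_cases h1 : v = a 1
    · exact ⟨1, h1.symm⟩
    by_cases h2 : v = a 2
    · exact ⟨2, h2.symm⟩
    by_cases h3 : v = a 3
    · exact ⟨3, h3.symm⟩
    simp only [h0, h1, h2, h3, or_self, not_false_eq_true, and_true] at h
  · rintro ⟨i, rfl⟩
    fin_cases i <;> simp only [ha.eq_iff] <;> decide

end CurrentSide

/-! ## Aizenman's identity through the trace dictionary, product form -/

/-- **Aizenman's `U₄` identity in loop-O(1) dress, product form**, conditional on the same-graph
two-current trace dictionary `hSelf` for `G` at `β ≥ 0`: for an injective `a` and `t = tanh β`,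
`Z₀₁Z₂₃ + Z₀₂Z₁₃ + Z₀₃Z₁₂ = Z_A Z_∅ + 2·JJ`,
`JJ = Σ_{F ∈ 𝒯_A} Σ_{F′ ∈ 𝒯_∅} Σ_{η ⊆ E} 1[A joined in F ∪ F′ ∪ η] t^{|F|} t^{|F′|} (t²)^{|η|}(1−t²)^{|E|−|η|}`.
Steps: `Current.ursellFour_currentSum_identity`; `Current.tsum_epairWeight_switch_pair`;
`aizLoop_indicator_eq`; `hSelf`; `aizLoop_ecurrentSum_eq`; cancel `cosh(β)^{2|E|}`. -/
theorem aizLoop_pairingsIdentity :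
    ∀ (V : Type) [Fintype V] [DecidableEq V] (G : SimpleGraph V) [DecidableRel G.Adj] (β : ℝ),
      0 ≤ β →
      (∀ (A B : Finset V) (g : Finset (Sym2 V) → ℝ≥0∞),
        ∑' p : Current G × Current G,
            (if p.1.sources = A then p.1.eweight (fun _ => β) else 0) *
              (if p.2.sources = B then p.2.eweight (fun _ => β) else 0) *
              g (G.edgeFinset.filter fun e => e ∈ (p.1 + p.2).traced)
          = ENNReal.ofReal (Real.cosh β ^ (#G.edgeFinset + #G.edgeFinset)) *
            ∑ F ∈ tJoins G Set.univ A, ∑ F' ∈ tJoins G Set.univ B, ∑ η ∈ G.edgeFinset.powerset,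
              ENNReal.ofReal (Real.tanh β ^ #F * Real.tanh β ^ #F' *
                ((Real.tanh β ^ 2) ^ #η * (1 - Real.tanh β ^ 2) ^ (#G.edgeFinset - #η))) *
                g (F ∪ F' ∪ η)) →
      ∀ a : Fin 4 → V, Function.Injective a →
      (let t : ℝ := Real.tanh β
       loopO1PartitionFunction G t {a 0, a 1} * loopO1PartitionFunction G t {a 2, a 3} +
           loopO1PartitionFunction G t {a 0, a 2} * loopO1PartitionFunction G t {a 1, a 3} +
           loopO1PartitionFunction G t {a 0, a 3} * loopO1PartitionFunction G t {a 1, a 2} =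
         loopO1PartitionFunction G t (Finset.univ.image a) * loopO1PartitionFunction G t ∅ +
           2 * ∑ F ∈ tJoins G Set.univ (Finset.univ.image a), ∑ F' ∈ tJoins G Set.univ ∅,
             ∑ η ∈ G.edgeFinset.powerset,
               if (∀ i j : Fin 4, (SimpleGraph.fromEdgeSet (↑(F ∪ F' ∪ η) : Set (Sym2 V))).Reachable
                   (a i) (a j)) then
                 t ^ F.card * t ^ F'.card * ((t ^ 2) ^ η.card * (1 - t ^ 2) ^ (#G.edgeFinset - η.card))
               else 0) := by
  intro V _ _ G _ β hβ hSelf a ha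
  dsimp only
  set K : G.edgeFinset → ℝ := fun _ => β with hKdef
  have hK : ∀ e : G.edgeFinset, 0 ≤ K e := fun _ => hβ
  -- (1) the random-current identity for `U₄`
  have hId := Current.ursellFour_currentSum_identity (K := K) hK (a 0) (a 1) (a 2) (a 3)
  set D : Finset V := {a 0} ∆ ({a 1} ∆ ({a 2} ∆ {a 3})) with hD
  have hzt : D ∆ ({a 2} ∆ {a 3}) = {a 0} ∆ {a 1} := by
    rw [hD, symmDiff_assoc, symmDiff_assoc, symmDiff_self, symmDiff_bot]
  -- (2) switch the pair `a₂a₃` into the first current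
  have hP : ∑' p : Current G × Current G,
      epairWeight K ({a 0} ∆ {a 1}) ({a 2} ∆ {a 3}) p *
        (if a 2 ∈ (p.1 + p.2).cluster (a 0) then 1 else 0) =
      ∑' p : Current G × Current G, epairWeight K D ∅ p *
        ((if a 2 ∈ (p.1 + p.2).cluster (a 0) then 1 else 0) *
          (if a 3 ∈ (p.1 + p.2).cluster (a 2) then 1 else 0)) := by
    have h := Current.tsum_epairWeight_switch_pair hK D (a 2) (a 3)
      (fun m => if a 2 ∈ m.cluster (a 0) then 1 else 0)
    rw [hzt] at h
    exact h
  have hDimg : D = Finset.univ.image a := aizLoop_symmDiff_eq_image ha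
  have ht : 0 ≤ Real.tanh β := by
    rw [Real.tanh_eq_sinh_div_cosh]
    exact div_nonneg (Real.sinh_nonneg_iff.2 hβ) (Real.cosh_pos β).le
  have ht2 : 0 ≤ 1 - Real.tanh β ^ 2 := sub_nonneg.2 (Real.tanh_sq_lt_one β).le
  set cE : ℝ := Real.cosh β ^ #G.edgeFinset with hcE
  set Zt : Finset V → ℝ := fun S => loopO1PartitionFunction G (Real.tanh β) S with hZt
  set JJ : ℝ := ∑ F ∈ tJoins G Set.univ (Finset.univ.image a), ∑ F' ∈ tJoins G Set.univ ∅,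
    ∑ η ∈ G.edgeFinset.powerset,
      (if (∀ i j : Fin 4, Rch (F ∪ F' ∪ η) (a i) (a j)) then
        Real.tanh β ^ F.card * Real.tanh β ^ F'.card *
          ((Real.tanh β ^ 2) ^ η.card * (1 - Real.tanh β ^ 2) ^ (#G.edgeFinset - η.card))
      else 0) with hJJ
  have hcE0 : 0 < cE := pow_pos (Real.cosh_pos β) _
  have hZt0 : ∀ S, 0 ≤ Zt S := fun S => loopO1PartitionFunction_nonneg G ht S
  have hterm : ∀ F F' η : Finset (Sym2 V), 0 ≤ (if (∀ i j : Fin 4, Rch (F ∪ F' ∪ η) (a i) (a j))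
      then Real.tanh β ^ F.card * Real.tanh β ^ F'.card *
        ((Real.tanh β ^ 2) ^ η.card * (1 - Real.tanh β ^ 2) ^ (#G.edgeFinset - η.card))
      else 0) := by
    intro F F' η
    split_ifs
    · exact mul_nonneg (mul_nonneg (pow_nonneg ht _) (pow_nonneg ht _))
        (mul_nonneg (pow_nonneg (sq_nonneg _) _) (pow_nonneg ht2 _))
    · exact le_rfl
  have hJJ0 : 0 ≤ JJ :=
    Finset.sum_nonneg fun F _ => Finset.sum_nonneg fun F' _ => Finset.sum_nonneg fun η _ => hterm F F' η
  -- (3) parity: the product indicator is `1[A joined in the trace]`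
  set g : Finset (Sym2 V) → ℝ≥0∞ := fun S =>
    if (∀ i j : Fin 4, Rch S (a i) (a j)) then 1 else 0 with hg
  have hQ : ∑' p : Current G × Current G, epairWeight K D ∅ p *
        ((if a 2 ∈ (p.1 + p.2).cluster (a 0) then 1 else 0) *
          (if a 3 ∈ (p.1 + p.2).cluster (a 2) then 1 else 0)) =
      ∑' p : Current G × Current G,
        (if p.1.sources = Finset.univ.image a then p.1.eweight (fun _ => β) else 0) *
          (if p.2.sources = ∅ then p.2.eweight (fun _ => β) else 0) *
          g (G.edgeFinset.filter fun e => e ∈ (p.1 + p.2).traced) := by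
    refine tsum_congr fun p => ?_
    rw [epairWeight_eq_mul, hDimg]
    by_cases h1 : p.1.sources = Finset.univ.image a
    · by_cases h2 : p.2.sources = ∅
      · have hs : (p.1 + p.2).sources = Finset.univ.image a := by
          rw [Current.sources_add, h1, h2]
          exact symmDiff_bot _
        rw [aizLoop_indicator_eq G ha hs]
      · simp only [if_neg h2, mul_zero, zero_mul]
    · simp only [if_neg h1, zero_mul]
  -- (4) the dictionary
  have hDict := hSelf (Finset.univ.image a) ∅ g
  have hSum : (∑ F ∈ tJoins G Set.univ (Finset.univ.image a), ∑ F' ∈ tJoins G Set.univ ∅,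
      ∑ η ∈ G.edgeFinset.powerset,
        ENNReal.ofReal (Real.tanh β ^ #F * Real.tanh β ^ #F' *
          ((Real.tanh β ^ 2) ^ #η * (1 - Real.tanh β ^ 2) ^ (#G.edgeFinset - #η))) *
          g (F ∪ F' ∪ η)) = ENNReal.ofReal JJ := by
    rw [hJJ, ENNReal.ofReal_sum_of_nonneg (fun F _ => Finset.sum_nonneg fun F' _ =>
      Finset.sum_nonneg fun η _ => hterm F F' η)]
    refine Finset.sum_congr rfl fun F _ => ?_
    rw [ENNReal.ofReal_sum_of_nonneg (fun F' _ => Finset.sum_nonneg fun η _ => hterm F F' η)]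
    refine Finset.sum_congr rfl fun F' _ => ?_
    rw [ENNReal.ofReal_sum_of_nonneg (fun η _ => hterm F F' η)]
    refine Finset.sum_congr rfl fun η _ => ?_
    simp only [hg]
    by_cases hall : ∀ i j : Fin 4, Rch (F ∪ F' ∪ η) (a i) (a j)
    · rw [if_pos hall, if_pos hall, mul_one]
    · rw [if_neg hall, if_neg hall, mul_zero, ENNReal.ofReal_zero]
  rw [hSum] at hDict
  rw [hP, hQ, hDict] at hId
  -- (5) cast to `ℝ`
  have hZ : ∀ S, ecurrentSum K S = ENNReal.ofReal (cE * Zt S) := fun S => aizLoop_ecurrentSum_eq G hβ S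
  have hp : ∀ S T : Finset V, 0 ≤ cE * Zt S * (cE * Zt T) := fun S T =>
    mul_nonneg (mul_nonneg hcE0.le (hZt0 S)) (mul_nonneg hcE0.le (hZt0 T))
  have hc2 : Real.cosh β ^ (#G.edgeFinset + #G.edgeFinset) = cE * cE := pow_add _ _ _
  rw [hZ, hZ, hZ, hZ, hZ, hZ, hZ, hZ, hc2] at hId
  have eL : ENNReal.ofReal (cE * Zt ({a 0} ∆ {a 1})) * ENNReal.ofReal (cE * Zt ({a 2} ∆ {a 3})) +
        ENNReal.ofReal (cE * Zt ({a 0} ∆ {a 2})) * ENNReal.ofReal (cE * Zt ({a 1} ∆ {a 3})) +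
        ENNReal.ofReal (cE * Zt ({a 0} ∆ {a 3})) * ENNReal.ofReal (cE * Zt ({a 1} ∆ {a 2})) =
      ENNReal.ofReal (cE * Zt ({a 0} ∆ {a 1}) * (cE * Zt ({a 2} ∆ {a 3})) +
        cE * Zt ({a 0} ∆ {a 2}) * (cE * Zt ({a 1} ∆ {a 3})) +
        cE * Zt ({a 0} ∆ {a 3}) * (cE * Zt ({a 1} ∆ {a 2}))) := by
    rw [ENNReal.ofReal_add (add_nonneg (hp _ _) (hp _ _)) (hp _ _),
      ENNReal.ofReal_add (hp _ _) (hp _ _),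
      ENNReal.ofReal_mul (mul_nonneg hcE0.le (hZt0 _)),
      ENNReal.ofReal_mul (mul_nonneg hcE0.le (hZt0 _)),
      ENNReal.ofReal_mul (mul_nonneg hcE0.le (hZt0 _))]
  have eR : ENNReal.ofReal (cE * Zt D) * ENNReal.ofReal (cE * Zt ∅) +
        2 * (ENNReal.ofReal (cE * cE) * ENNReal.ofReal JJ) =
      ENNReal.ofReal (cE * Zt D * (cE * Zt ∅) + 2 * (cE * cE * JJ)) := by
    have h2 : (0 : ℝ) ≤ 2 * (cE * cE * JJ) :=
      mul_nonneg (by norm_num) (mul_nonneg (mul_nonneg hcE0.le hcE0.le) hJJ0)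
    rw [ENNReal.ofReal_add (hp _ _) h2, ENNReal.ofReal_mul (mul_nonneg hcE0.le (hZt0 _)),
      ENNReal.ofReal_mul (by norm_num : (0 : ℝ) ≤ 2), ENNReal.ofReal_ofNat,
      ENNReal.ofReal_mul (mul_nonneg hcE0.le hcE0.le)]
  rw [eL, eR, ENNReal.ofReal_eq_ofReal_iff (add_nonneg (add_nonneg (hp _ _) (hp _ _)) (hp _ _))
    (add_nonneg (hp _ _) (mul_nonneg (by norm_num)
      (mul_nonneg (mul_nonneg hcE0.le hcE0.le) hJJ0)))] at hId
  -- (6) the source sets as plain finsets, and cancel `cE²`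
  have h01 : ({a 0} : Finset V) ∆ {a 1} = {a 0, a 1} :=
    Current.symmDiff_singleton_eq_pair (ha.ne (by decide))
  have h23 : ({a 2} : Finset V) ∆ {a 3} = {a 2, a 3} :=
    Current.symmDiff_singleton_eq_pair (ha.ne (by decide))
  have h02 : ({a 0} : Finset V) ∆ {a 2} = {a 0, a 2} :=
    Current.symmDiff_singleton_eq_pair (ha.ne (by decide))
  have h13 : ({a 1} : Finset V) ∆ {a 3} = {a 1, a 3} :=
    Current.symmDiff_singleton_eq_pair (ha.ne (by decide))
  have h03 : ({a 0} : Finset V) ∆ {a 3} = {a 0, a 3} :=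
    Current.symmDiff_singleton_eq_pair (ha.ne (by decide))
  have h12 : ({a 1} : Finset V) ∆ {a 2} = {a 1, a 2} :=
    Current.symmDiff_singleton_eq_pair (ha.ne (by decide))
  rw [h01, h23, h02, h13, h03, h12, hDimg] at hId
  have hcc : cE * cE ≠ 0 := mul_ne_zero hcE0.ne' hcE0.ne'
  apply mul_left_cancel₀ hcc
  simp only [hZt] at hId
  linear_combination hId

end Summit.CriticalPhenomena.Ising3DConformalLimit.Theorems.StrandShadowOddCut

end
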